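import Mathlib.MeasureTheory.Function.LpSpace.Complete
import Mathlib.MeasureTheory.Function.LpSeminorm.CompareExp
import Literature.Analysis.FunctionSpaces.MeyersSerrinProofs
import Literature.Analysis.FunctionSpaces.SobolevDomainNormProofs
import HarnessLib

/-!
# Completeness of `W^{k,p}(Ω)`

H. Brezis, *Functional Analysis, Sobolev Spaces and Partial Differential Equations* (2011),
§9.1, Proposition 9.1: "`W^{1,p}(Ω)` is a Banach space for `1 ≤ p ≤ ∞`", proved from the
completeness of `L^p`: if `(uₙ)` is Cauchy in `W^{1,p}` then `uₙ → u` and `∂ᵢuₙ → gᵢ` in `L^p`,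
and passing to the limit in `∫ uₙ ∂ᵢφ = -∫ (∂ᵢuₙ) φ` shows `gᵢ = ∂ᵢu`; the same for `W^{m,p}`
(Adams, *Sobolev Spaces* (1975), Theorem 3.2). This file proves the statement for the Sobolev
classes `Literature.MemSobolevDomain k p Ω μ` with the extended norm `Literature.Analysis.FunctionSpaces.eSobolevDomainNorm` on an open
subset `Ω` of a finite-dimensional real normed space, for `1 ≤ p ≤ ∞` and a complete codomain
(`Literature.Analysis.FunctionSpaces.exists_memSobolevDomain_tendsto_of_cauchy`), by induction on `k`:

* `k = 0`: completeness of `L^p` (Mathlib's `MeasureTheory.Lp` is a complete space);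
* `k + 1`: the components of the weak derivatives are Cauchy in `W^{k,p}(Ω)` (the infimum in
  the norm is attained at every weak derivative, `MeyersSerrin.eSobolevDomainNorm_succ_eq`),
  the limits `gᵢ` assemble into `G = Σᵢ coordᵢ ⊗ gᵢ`, and `G` is a weak derivative of the
  `L^p`-limit `u` because both sides of the defining identity pass to the limit
  (`Literature.Analysis.FunctionSpaces.tendsto_setIntegral_smul_of_tendsto_eLpNorm`: pairing with a bounded compactly supported
  function is continuous for `L^p(Ω)`-convergence, by Hölder's inequality on the support).

## References

* H. Brezis, *Functional Analysis, Sobolev Spaces and PDE*, Springer (2011), §9.1, Prop. 9.1.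
* R. A. Adams, *Sobolev Spaces*, Academic Press (1975), Theorem 3.2 (`W^{m,p}(Ω)` is a Banach
  space).
-/

noncomputable section

open MeasureTheory TopologicalSpace Filter Set Metric Function
open scoped ENNReal NNReal Topology

namespace Literature.Analysis.FunctionSpaces

section Pairing

variable {E' : Type*} [NormedAddCommGroup E'] [NormedSpace ℝ E'] [MeasurableSpace E']
  [OpensMeasurableSpace E'] [LocallyCompactSpace E']
variable {F : Type*} [NormedAddCommGroup F] [NormedSpace ℝ F]

omit [NormedSpace ℝ E'] in
/-- **Pairing with a bounded compactly supported function is continuous in `L^p(Ω)`**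
(`1 ≤ p`): if `‖fₙ - f‖_{L^p(Ω)} → 0`, `ψ` is continuous with compact support inside the open
set `Ω`, and the `fₙ`, `f` are locally integrable on `Ω`, then `∫_Ω ψ • fₙ → ∫_Ω ψ • f`
(Hölder's inequality on the compact `tsupport ψ`, which has finite measure). [folklore] -/
theorem tendsto_setIntegral_smul_of_tendsto_eLpNorm {Ω : Opens E'} {μ : Measure E'}
    [IsFiniteMeasureOnCompacts μ] {p : ℝ≥0∞} (hp : 1 ≤ p) {ψ : E' → ℝ} (hψ : Continuous ψ)
    (hψc : HasCompactSupport ψ) (hψs : tsupport ψ ⊆ (Ω : Set E')) {f : ℕ → E' → F} {g : E' → F}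
    (hf : ∀ n, MemLp (f n) p (μ.restrict Ω)) (hg : MemLp g p (μ.restrict Ω))
    (hlim : Tendsto (fun n => eLpNorm (f n - g) p (μ.restrict Ω)) atTop (𝓝 0)) :
    Tendsto (fun n => ∫ x in (Ω : Set E'), ψ x • f n x ∂μ) atTop
      (𝓝 (∫ x in (Ω : Set E'), ψ x • g x ∂μ)) := by
  obtain ⟨S, hS⟩ : ∃ S, ∀ x, ‖ψ x‖ ≤ S := hψ.bounded_above_of_compact_support hψc
  have hS0 : 0 ≤ S := (norm_nonneg _).trans (hS 0)
  set K : Set E' := tsupport ψ with hK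
  have hKc : IsCompact K := hψc
  have hKm : MeasurableSet K := (isClosed_tsupport ψ).measurableSet
  have hKμ : μ K < ⊤ := hKc.measure_lt_top
  haveI hKfin : IsFiniteMeasure (μ.restrict K) := ⟨by rwa [Measure.restrict_apply_univ]⟩
  have hp0 : p ≠ 0 := (lt_of_lt_of_le one_pos hp).ne'
  have hμKΩ : μ.restrict K ≤ μ.restrict Ω := Measure.restrict_mono hψs le_rfl
  -- local integrability on `Ω` and integrability on `K`
  have hloc : ∀ {h : E' → F}, MemLp h p (μ.restrict Ω) → LocallyIntegrableOn h (Ω : Set E') μ :=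
    fun {h} hh => (locallyIntegrableOn_iff Ω.isOpen.isLocallyClosed).2 fun K' hK' hK'c => by
      haveI : IsFiniteMeasure (μ.restrict K') :=
        ⟨by rw [Measure.restrict_apply_univ]; exact hK'c.measure_lt_top⟩
      exact ((hh.mono_measure (Measure.restrict_mono hK' le_rfl)).mono_exponent hp).integrable le_rfl
  have hfl : ∀ n, LocallyIntegrableOn (f n) (Ω : Set E') μ := fun n => hloc (hf n)
  have hgl : LocallyIntegrableOn g (Ω : Set E') μ := hloc hg
  have hdK : ∀ n, Integrable (f n - g) (μ.restrict K) := fun n => by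
    have h1 : MemLp (f n - g) p (μ.restrict K) := ((hf n).sub hg).mono_measure hμKΩ
    exact (h1.mono_exponent hp).integrable le_rfl
  -- `‖fₙ - g‖_{L¹(K)} → 0`
  have hL1 : Tendsto (fun n => eLpNorm (f n - g) 1 (μ.restrict K)) atTop (𝓝 0) := by
    have hbound : ∀ n, eLpNorm (f n - g) 1 (μ.restrict K) ≤
        eLpNorm (f n - g) p (μ.restrict Ω) * μ K ^ (1 / (1 : ℝ≥0∞).toReal - 1 / p.toReal) := by
      intro n
      have h1 := eLpNorm_le_eLpNorm_mul_rpow_measure_univ hp (hdK n).1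
      rw [Measure.restrict_apply_univ] at h1
      exact h1.trans (mul_le_mul_left (eLpNorm_mono_measure _ hμKΩ) _)
    have hfin : μ K ^ (1 / (1 : ℝ≥0∞).toReal - 1 / p.toReal) ≠ ⊤ :=
      ENNReal.rpow_ne_top_of_nonneg (by
        simp only [ENNReal.toReal_one, div_one, sub_nonneg]
        rcases eq_or_ne p ⊤ with rfl | hpT
        · simp
        · rw [div_le_one (ENNReal.toReal_pos hp0 hpT)]
          have := (ENNReal.toReal_le_toReal ENNReal.one_ne_top hpT).2 hp
          rwa [ENNReal.toReal_one] at this) hKμ.ne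
    refine tendsto_of_tendsto_of_tendsto_of_le_of_le tendsto_const_nhds ?_ (fun n => bot_le) hbound
    have := ENNReal.Tendsto.mul_const hlim (Or.inr hfin)
    rwa [zero_mul] at this
  have hL1' : Tendsto (fun n => (eLpNorm (f n - g) 1 (μ.restrict K)).toReal) atTop (𝓝 0) := by
    have := (ENNReal.tendsto_toReal ENNReal.zero_ne_top).comp hL1
    rwa [ENNReal.toReal_zero] at this
  -- the integrals differ by `∫_K ψ • (fₙ - g)`, bounded by `S ‖fₙ - g‖_{L¹(K)}`
  have hint : ∀ n, IntegrableOn (fun x => ψ x • f n x) (Ω : Set E') μ := fun n =>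
    SobolevApprox.integrableOn_continuous_smul hψ hψc hψs (hfl n)
  have hintg : IntegrableOn (fun x => ψ x • g x) (Ω : Set E') μ :=
    SobolevApprox.integrableOn_continuous_smul hψ hψc hψs hgl
  rw [tendsto_iff_norm_sub_tendsto_zero]
  have hle : ∀ n, ‖∫ x in (Ω : Set E'), ψ x • f n x ∂μ - ∫ x in (Ω : Set E'), ψ x • g x ∂μ‖ ≤
      S * (eLpNorm (f n - g) 1 (μ.restrict K)).toReal := fun n => by
    rw [← integral_sub (hint n) hintg]
    have e1 : ∫ x in (Ω : Set E'), (ψ x • f n x - ψ x • g x) ∂μ =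
        ∫ x in K, ψ x • (f n - g) x ∂μ := by
      rw [setIntegral_eq_of_subset_of_forall_sdiff_eq_zero Ω.isOpen.measurableSet hψs]
      · refine setIntegral_congr_fun hKm fun x _ => ?_
        rw [Pi.sub_apply, smul_sub]
      · rintro x ⟨-, hx⟩
        rw [image_eq_zero_of_notMem_tsupport hx, zero_smul, zero_smul, sub_zero]
    rw [e1]
    have hi1 : Integrable (fun x => S * ‖(f n - g) x‖) (μ.restrict K) :=
      ((hdK n).norm).const_mul S
    calc ‖∫ x in K, ψ x • (f n - g) x ∂μ‖ ≤ ∫ x in K, ‖ψ x • (f n - g) x‖ ∂μ :=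
          norm_integral_le_integral_norm _
      _ ≤ ∫ x in K, S * ‖(f n - g) x‖ ∂μ := by
          refine integral_mono_of_nonneg (Eventually.of_forall fun x => norm_nonneg _) hi1
            (Eventually.of_forall fun x => ?_)
          dsimp only
          rw [norm_smul]
          exact mul_le_mul_of_nonneg_right (hS x) (norm_nonneg _)
      _ = S * (eLpNorm (f n - g) 1 (μ.restrict K)).toReal := by
          rw [MeasureTheory.integral_const_mul, integral_norm_eq_lintegral_enorm (hdK n).1,
            eLpNorm_one_eq_lintegral_enorm]
  refine squeeze_zero (fun n => norm_nonneg _) hle ?_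
  simpa using hL1'.const_mul S

end Pairing

section Lp

variable {α : Type*} [MeasurableSpace α] {ν : Measure α}
variable {F : Type*} [NormedAddCommGroup F] [CompleteSpace F]

/-- **`L^p` is complete**, in function form (`1 ≤ p`): a sequence of `L^p` functions which is
Cauchy for the `L^p` seminorm converges in `L^p` to some `L^p` function (Mathlib's
`MeasureTheory.Lp` is a complete metric space; Riesz–Fischer). Mathlib's function-level
statement `MeasureTheory.Lp.cauchy_complete_eLpNorm` asks for a summable modulus `B N` of the
Cauchy condition; this is the plain `ε`–`N` form used below. [folklore] -/
theorem exists_memLp_tendsto_of_cauchy {p : ℝ≥0∞} (hp : 1 ≤ p) {f : ℕ → α → F}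
    (hf : ∀ n, MemLp (f n) p ν)
    (hC : ∀ ε : ℝ≥0∞, 0 < ε → ∃ N, ∀ n ≥ N, ∀ m ≥ N, eLpNorm (f n - f m) p ν < ε) :
    ∃ g : α → F, MemLp g p ν ∧ Tendsto (fun n => eLpNorm (f n - g) p ν) atTop (𝓝 0) := by
  haveI : Fact (1 ≤ p) := ⟨hp⟩
  set u : ℕ → Lp F p ν := fun n => (hf n).toLp (f n) with hu
  have hdiff : ∀ n m, eLpNorm (⇑(u n) - ⇑(u m)) p ν = eLpNorm (f n - f m) p ν := fun n m =>
    eLpNorm_congr_ae (((hf n).coeFn_toLp).sub ((hf m).coeFn_toLp))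
  have hcau : CauchySeq u := by
    refine Metric.cauchySeq_iff.2 fun ε hε => ?_
    obtain ⟨N, hN⟩ := hC (ENNReal.ofReal ε) (ENNReal.ofReal_pos.2 hε)
    refine ⟨N, fun m hm n hn => ?_⟩
    rw [Lp.dist_def, hdiff]
    exact ENNReal.toReal_lt_of_lt_ofReal (hN m hm n hn)
  obtain ⟨U, hU⟩ := cauchySeq_tendsto_of_complete hcau
  refine ⟨U, Lp.memLp U, ?_⟩
  rw [Lp.tendsto_Lp_iff_tendsto_eLpNorm'] at hU
  refine hU.congr fun n => eLpNorm_congr_ae ?_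
  exact ((hf n).coeFn_toLp).sub EventuallyEq.rfl

end Lp

section Complete

variable {E' : Type*} [NormedAddCommGroup E'] [NormedSpace ℝ E'] [MeasurableSpace E']
  [BorelSpace E'] [FiniteDimensional ℝ E']
variable {F : Type*} [NormedAddCommGroup F] [NormedSpace ℝ F] [CompleteSpace F]

/-- **`W^{k,p}(Ω)` is complete** (Brezis, *Functional Analysis* (2011), §9.1, Proposition 9.1;
Adams, *Sobolev Spaces* (1975), Theorem 3.2): for `1 ≤ p ≤ ∞`, an open `Ω`, a measure finite on
compact sets and a complete codomain, every sequence in `W^{k,p}(Ω)` which is Cauchy for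
`‖·‖_{W^{k,p}(Ω)}` converges in `W^{k,p}(Ω)` to some element of `W^{k,p}(Ω)`. By induction on
`k`: `L^p` is complete; the components of the weak derivatives are Cauchy in `W^{k,p}(Ω)` and
converge to `gᵢ`; and `Σᵢ coordᵢ ⊗ gᵢ` is a weak derivative of the `L^p` limit, both sides of
the defining identity passing to the limit. [cite: Brezis2011, §9.1 Proposition 9.1] -/
theorem exists_memSobolevDomain_tendsto_of_cauchy (Ω : Opens E') (μ : Measure E')
    [IsFiniteMeasureOnCompacts μ] {p : ℝ≥0∞} (hp : 1 ≤ p) (k : ℕ) :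
    ∀ {f : ℕ → E' → F}, (∀ n, MemSobolevDomain k p Ω μ (f n)) →
      (∀ ε : ℝ≥0∞, 0 < ε → ∃ N, ∀ n ≥ N, ∀ m ≥ N, eSobolevDomainNorm k p Ω μ (f n - f m) < ε) →
      ∃ g : E' → F, MemSobolevDomain k p Ω μ g ∧
        Tendsto (fun n => eSobolevDomainNorm k p Ω μ (f n - g)) atTop (𝓝 0) := by
  induction k with
  | zero =>
    intro f hf hC
    simp only [memSobolevDomain_zero_iff, eSobolevDomainNorm_zero] at hf hC ⊢
    exact exists_memLp_tendsto_of_cauchy hp hf hC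
  | succ k ih =>
    intro f hf hC
    set bB := Module.finBasis ℝ E' with hbB
    have hf0 : ∀ n, MemLp (f n) p (μ.restrict Ω) := fun n => (hf n).1
    choose G hG hGk using fun n => (hf n).2
    -- the norm of differences at the weak derivatives `G n - G m`
    have hnorm : ∀ n m, eSobolevDomainNorm (k + 1) p Ω μ (f n - f m) =
        eLpNorm (f n - f m) p (μ.restrict Ω) +
          ∑ i, eSobolevDomainNorm k p Ω μ (fun x => (G n - G m) x (bB i)) := fun n m =>
      MeyersSerrin.eSobolevDomainNorm_succ_eq (SobolevApprox.hasWeakFDerivOn_sub (hG n) (hG m))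
    -- the `L^p` limit
    obtain ⟨g, hgp, hglim⟩ := exists_memLp_tendsto_of_cauchy hp hf0 fun ε hε => by
      obtain ⟨N, hN⟩ := hC ε hε
      exact ⟨N, fun n hn m hm => lt_of_le_of_lt (by rw [hnorm]; exact le_self_add) (hN n hn m hm)⟩
    -- the limits of the components of the weak derivatives
    have hcomp : ∀ i, ∃ Hi : E' → F, MemSobolevDomain k p Ω μ Hi ∧
        Tendsto (fun n => eSobolevDomainNorm k p Ω μ ((fun x => G n x (bB i)) - Hi)) atTop (𝓝 0) := by
      intro i
      refine ih (fun n => hGk n (bB i)) fun ε hε => ?_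
      obtain ⟨N, hN⟩ := hC ε hε
      refine ⟨N, fun n hn m hm => lt_of_le_of_lt ?_ (hN n hn m hm)⟩
      rw [hnorm]
      have e : ((fun x => G n x (bB i)) - fun x => G m x (bB i)) = fun x => (G n - G m) x (bB i) := by
        funext x; simp
      rw [e]
      exact le_add_left (Finset.single_le_sum (f := fun i => eSobolevDomainNorm k p Ω μ
        (fun x => (G n - G m) x (bB i))) (fun _ _ => zero_le) (Finset.mem_univ i))
    choose H hH hHlim using hcomp
    -- the candidate weak derivative of the limit
    set Gl : E' → E' →L[ℝ] F := fun x => ∑ i, ((bB.coord i).toContinuousLinearMap).smulRight (H i x)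
      with hGl
    have hGl_apply : ∀ x v, Gl x v = ∑ i, (bB.coord i v) • H i x := fun x v => by
      simp only [hGl, FunLike.coe_sum, Finset.sum_apply,
        ContinuousLinearMap.smulRight_apply, LinearMap.coe_toContinuousLinearMap']
    have hGl_basis : ∀ x j, Gl x (bB j) = H j x := fun x j => by
      rw [hGl_apply]
      simp only [Module.Basis.coord_apply, Module.Basis.repr_self, Finsupp.single_apply]
      rw [Finset.sum_eq_single j]
      · simp
      · intro i _ hij; simp [Ne.symm hij]
      · intro h; exact absurd (Finset.mem_univ j) h
    -- local integrability from `L^p`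
    have hloc : ∀ {h : E' → F}, MemLp h p (μ.restrict Ω) → LocallyIntegrableOn h (Ω : Set E') μ :=
      fun {h} hh => (locallyIntegrableOn_iff Ω.isOpen.isLocallyClosed).2 fun K' hK' hK'c => by
        haveI : IsFiniteMeasure (μ.restrict K') :=
          ⟨by rw [Measure.restrict_apply_univ]; exact hK'c.measure_lt_top⟩
        exact ((hh.mono_measure (Measure.restrict_mono hK' le_rfl)).mono_exponent hp).integrable le_rfl
    have hHloc : ∀ i, LocallyIntegrableOn (H i) (Ω : Set E') μ := fun i => hloc (hH i).memLp
    have hGlloc : LocallyIntegrableOn Gl (Ω : Set E') μ := by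
      refine (locallyIntegrableOn_iff Ω.isOpen.isLocallyClosed).2 fun K' hK' hK'c => ?_
      have h1 : ∀ i, Integrable (fun x => ((bB.coord i).toContinuousLinearMap).smulRight (H i x))
          (μ.restrict K') := fun i =>
        (ContinuousLinearMap.smulRightL ℝ E' F ((bB.coord i).toContinuousLinearMap)).integrable_comp
          ((hHloc i).integrableOn_compact_subset hK' hK'c)
      have h2 : Integrable
          (fun x => ∑ i, ‖((bB.coord i).toContinuousLinearMap).smulRight (H i x)‖)
          (μ.restrict K') := integrable_finsetSum Finset.univ fun i _ => (h1 i).norm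
      refine h2.mono' ?_ (Eventually.of_forall fun x => norm_sum_le _ _)
      have e : Gl = ∑ i, fun x => ((bB.coord i).toContinuousLinearMap).smulRight (H i x) := by
        funext x; simp only [hGl, Finset.sum_apply]
      rw [e]
      exact Finset.aestronglyMeasurable_sum Finset.univ fun i _ => (h1 i).aestronglyMeasurable
    -- the weak derivative identity passes to the limit
    have hW : HasWeakFDerivOn Ω μ g Gl := by
      refine ⟨hloc hgp, hGlloc, fun φ v hφ => ?_⟩
      have hψ : Continuous fun x => fderiv ℝ φ x v :=
        (hφ.contDiff.continuous_fderiv (by simp)).clm_apply continuous_const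
      have hψc : HasCompactSupport fun x => fderiv ℝ φ x v := hφ.hasCompactSupport.fderiv_apply (𝕜 := ℝ) v
      have hψs : tsupport (fun x => fderiv ℝ φ x v) ⊆ (Ω : Set E') :=
        (tsupport_fderiv_apply_subset ℝ v).trans hφ.tsupport_subset
      -- left-hand sides converge
      have hL := tendsto_setIntegral_smul_of_tendsto_eLpNorm hp hψ hψc hψs hf0 hgp hglim
      -- right-hand sides converge
      have hGp : ∀ n i, MemLp (fun x => G n x (bB i)) p (μ.restrict Ω) := fun n i => (hGk n (bB i)).memLp
      have hR : ∀ i, Tendsto (fun n => ∫ x in (Ω : Set E'), φ x • G n x (bB i) ∂μ) atTop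
          (𝓝 (∫ x in (Ω : Set E'), φ x • H i x ∂μ)) := fun i =>
        tendsto_setIntegral_smul_of_tendsto_eLpNorm hp hφ.contDiff.continuous hφ.hasCompactSupport
          hφ.tsupport_subset (hGp · i) (hH i).memLp (tendsto_of_tendsto_of_tendsto_of_le_of_le
            tendsto_const_nhds (hHlim i) (fun n => bot_le) fun n => eLpNorm_le_eSobolevDomainNorm)
      -- expand the directional derivative along the basis
      have hexp : ∀ n, ∫ x in (Ω : Set E'), φ x • G n x v ∂μ =
          ∑ i, (bB.coord i v) • ∫ x in (Ω : Set E'), φ x • G n x (bB i) ∂μ := fun n => by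
        have e : ∀ x, φ x • G n x v = ∑ i, (bB.coord i v) • (φ x • G n x (bB i)) := fun x => by
          conv_lhs => rw [← bB.sum_repr v]
          simp only [map_sum, map_smul, Finset.smul_sum, Module.Basis.coord_apply]
          refine Finset.sum_congr rfl fun i _ => ?_
          rw [smul_comm]
        simp_rw [e]
        rw [integral_finsetSum _ fun i _ => ?_]
        · exact Finset.sum_congr rfl fun i _ => integral_smul _ _
        · exact (SobolevApprox.integrableOn_testFunction_smul hφ ((hloc (hGp n i)))).smul _
      have hexpl : ∫ x in (Ω : Set E'), φ x • Gl x v ∂μ =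
          ∑ i, (bB.coord i v) • ∫ x in (Ω : Set E'), φ x • H i x ∂μ := by
        have e : ∀ x, φ x • Gl x v = ∑ i, (bB.coord i v) • (φ x • H i x) := fun x => by
          rw [hGl_apply, Finset.smul_sum]
          refine Finset.sum_congr rfl fun i _ => ?_
          rw [smul_comm]
        simp_rw [e]
        rw [integral_finsetSum _ fun i _ => ?_]
        · exact Finset.sum_congr rfl fun i _ => integral_smul _ _
        · exact (SobolevApprox.integrableOn_testFunction_smul hφ (hHloc i)).smul _
      have hR' : Tendsto (fun n => -∫ x in (Ω : Set E'), φ x • G n x v ∂μ) atTop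
          (𝓝 (-∫ x in (Ω : Set E'), φ x • Gl x v ∂μ)) := by
        simp only [hexp, hexpl]
        exact (tendsto_finsetSum _ fun i _ => (hR i).const_smul _).neg
      have heq : (fun n => ∫ x in (Ω : Set E'), (fderiv ℝ φ x v) • f n x ∂μ) =
          fun n => -∫ x in (Ω : Set E'), φ x • G n x v ∂μ :=
        funext fun n => (hG n).integral_fderiv_smul_eq φ v hφ
      rw [heq] at hL
      exact tendsto_nhds_unique hL hR'
    -- membership and convergence
    refine ⟨g, ⟨hgp, Gl, hW, fun v => ?_⟩, ?_⟩
    · have e : (fun x => Gl x v) = ∑ i, (bB.coord i v) • fun x => H i x := by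
        funext x; simp only [hGl_apply, Finset.sum_apply, Pi.smul_apply]
      rw [e]
      exact MemSobolevDomain.sum fun i _ => (hH i).const_smul _
    · have hn : ∀ n, eSobolevDomainNorm (k + 1) p Ω μ (f n - g) =
          eLpNorm (f n - g) p (μ.restrict Ω) +
            ∑ i, eSobolevDomainNorm k p Ω μ ((fun x => G n x (bB i)) - H i) := fun n => by
        rw [MeyersSerrin.eSobolevDomainNorm_succ_eq (SobolevApprox.hasWeakFDerivOn_sub (hG n) hW)]
        congr 1
        refine Finset.sum_congr rfl fun i _ => ?_
        congr 1
        funext x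
        show (G n x - Gl x) (bB i) = _
        rw [_root_.sub_apply, hGl_basis]
        rfl
      simp only [hn]
      have := hglim.add (tendsto_finsetSum Finset.univ fun i (_ : i ∈ Finset.univ) => hHlim i)
      simpa using this

end Complete

end Literature.Analysis.FunctionSpaces
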